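import Literature.Geometry.Riemannian.RicciFlowVolumeDensity
import Literature.Geometry.Lorentzian.MetricDensityRatio
import Mathlib.Analysis.Calculus.Deriv.Shift
import HarnessLib

/-!
# The density ratio along a Ricci flow: `ρ(g(t), g₀) = e^{−∫ₛᵗ R} ρ(g(s), g₀)` and
# `∂ₜ ρ(g(t), g₀) = −R ρ(g(t), g₀)` (Topping 2006, (2.5.7))

Topping, *Lectures on the Ricci flow* (2006), (2.5.7): under the Ricci flow the volume form evolves
by `∂ₜ dV = −R dV`. The tree has the integrated chart form
(`IsRicciFlow.sqrt_det_chartGramMatrix_eq_exp_mul`, `RicciFlowVolumeDensity.lean`) and the density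
ratio `ρ(g, g₀) = dV_g/dV_{g₀}` of two metrics (`PseudoRiemannianMetric.densityRatio`,
`MetricDensityRatio.lean`). This file combines them into the POINTWISE statements

* `IsRicciFlow.densityRatio_eq_exp_mul_densityRatio` — for a Ricci flow of Riemannian metrics on a
  convex time set `S`, `s, t ∈ S`, and any Riemannian reference metric `g₀`:
  `ρ(g(t), g₀)(p) = exp (−∫ₛᵗ R(p, τ) dτ) · ρ(g(s), g₀)(p)`;
* `IsRicciFlow.hasDerivAt_densityRatio` — at an interior time `t` of `S`,
  `∂ₜ ρ(g(t), g₀)(p) = −R(p, t) ρ(g(t), g₀)(p)` (**(2.5.7)** for the density ratio);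
* `IsRicciFlow.deriv_densityRatio_div`, `IsRicciFlow.deriv_densityRatio_comp_neg_div` — the
  logarithmic derivatives `∂ₜρ/ρ = −R` and, for the time-reversed family `σ ↦ g(−σ)`,
  `∂_σρ/ρ = R(·, −σ)` (the coefficient of the heat-type equation satisfied by the time-reversed
  conjugate heat kernel, Bamler 2020a, §2.3).

Everything is proved; no definitions, no named facts.

## References

* P. Topping, *Lectures on the Ricci flow*, LMS Lecture Note Series 325 (2006), Prop. 2.3.12,
  (2.5.7). [Topping2006]
-/

noncomputable section

open Bundle Set Function Filter Manifold MeasureTheory intervalIntegral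
open scoped Manifold ContDiff Topology

namespace Literature.Geometry.Riemannian

open Lorentzian Lorentzian.PseudoRiemannianMetric

variable {m : ℕ} {H : Type*} [TopologicalSpace H]
  {I : ModelWithCorners ℝ (EuclideanSpace ℝ (Fin m)) H}
  {M : Type*} [TopologicalSpace M] [ChartedSpace H M] [IsManifold I ∞ M]
  {g : ℝ → PseudoRiemannianMetric I ∞ (EuclideanSpace ℝ (Fin m)) (TangentSpace I : M → Type _)}
  {cov : ℝ → CovariantDerivative I (EuclideanSpace ℝ (Fin m)) (TangentSpace I : M → Type _)}
  {S : Set ℝ}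
  {g₀ : PseudoRiemannianMetric I ∞ (EuclideanSpace ℝ (Fin m)) (TangentSpace I : M → Type _)}

/-- **`ρ(g(t), g₀) = e^{−∫ₛᵗ R} ρ(g(s), g₀)` along a Ricci flow** (Topping 2006, (2.5.7),
integrated, for the density ratio against a fixed Riemannian reference metric `g₀`): the chart
densities satisfy `√det g_{ij}(t) = e^{−∫ₛᵗ R} √det g_{ij}(s)`
(`IsRicciFlow.sqrt_det_chartGramMatrix_eq_exp_mul`) and `ρ(g, g₀) √det (g₀)_{ij} = √det g_{ij}`
(`densityRatio_mul_sqrt_det_chartGramMatrix`). [cite: Topping2006, (2.5.7) (p. 33)] -/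
theorem IsRicciFlow.densityRatio_eq_exp_mul_densityRatio (hflow : IsRicciFlow g cov S)
    (hS : Convex ℝ S) (hR : ∀ t ∈ S, (g t).IsRiemannian) (hR₀ : g₀.IsRiemannian) {s t : ℝ}
    (hs : s ∈ S) (ht : t ∈ S) (p : M) :
    (g t).densityRatio g₀ p =
      Real.exp (-∫ τ in s..t, (g τ).scalarCurvatureWith (cov τ) p) * (g s).densityRatio g₀ p := by
  set y : EuclideanSpace ℝ (Fin m) := extChartAt I p p with hy
  have hyt : y ∈ (extChartAt I p).target := mem_extChartAt_target p
  have hpy : (extChartAt I p).symm y = p := by rw [hy]; exact extChartAt_to_inv p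
  have e1 := densityRatio_mul_sqrt_det_chartGramMatrix (hR t ht) hR₀ p hyt
  have e2 := hflow.sqrt_det_chartGramMatrix_eq_exp_mul hS hR hs ht p hyt
  have e3 := densityRatio_mul_sqrt_det_chartGramMatrix (hR s hs) hR₀ p hyt
  rw [hpy] at e1 e2 e3
  have hpos := sqrt_det_chartGramMatrix_pos (g₀.toContMDiffRiemannianMetric hR₀) p hyt
  have key : (g t).densityRatio g₀ p *
      Real.sqrt (chartGramMatrix (g₀.toContMDiffRiemannianMetric hR₀) p y).det =
      (Real.exp (-∫ τ in s..t, (g τ).scalarCurvatureWith (cov τ) p) * (g s).densityRatio g₀ p) *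
        Real.sqrt (chartGramMatrix (g₀.toContMDiffRiemannianMetric hR₀) p y).det := by
    rw [e1, e2, ← e3, mul_assoc]
  exact mul_right_cancel₀ hpos.ne' key

/-- **`∂ₜ ρ(g(t), g₀) = −R ρ(g(t), g₀)`** (Topping 2006, (2.5.7) `∂ₜ dV = −R dV`, for the density
ratio against a fixed Riemannian reference metric): at an interior time `t` of the convex time
set `S` of a Ricci flow of Riemannian metrics, `t ↦ ρ(g(t), g₀)(p)` is differentiable with
derivative `−R(p, t) ρ(g(t), g₀)(p)` (`densityRatio_eq_exp_mul_densityRatio` with base time `t`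
and the fundamental theorem of calculus, `R(p, ·)` being continuous on `S`,
`IsRicciFlow.continuousOn_scalarCurvatureWith`). [cite: Topping2006, (2.5.7) (p. 33)] -/
theorem IsRicciFlow.hasDerivAt_densityRatio [I.Boundaryless] (hflow : IsRicciFlow g cov S)
    (hS : Convex ℝ S) (hR : ∀ t ∈ S, (g t).IsRiemannian) (hR₀ : g₀.IsRiemannian) {t : ℝ}
    (ht : t ∈ interior S) (p : M) :
    HasDerivAt (fun r ↦ (g r).densityRatio g₀ p)
      (-(g t).scalarCurvatureWith (cov t) p * (g t).densityRatio g₀ p) t := by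
  have htS : t ∈ S := interior_subset ht
  have hU : UniqueDiffOn ℝ S := uniqueDiffOn_convex hS ⟨t, ht⟩
  set Rp : ℝ → ℝ := fun τ ↦ (g τ).scalarCurvatureWith (cov τ) p with hRp
  have hRc : ContinuousOn Rp S := hflow.continuousOn_scalarCurvatureWith hU p
  have hRi : ContinuousOn Rp (interior S) := hRc.mono interior_subset
  have hRat : ContinuousAt Rp t := (hRi t ht).continuousAt (isOpen_interior.mem_nhds ht)
  -- `F r = ∫ₜʳ R(p, τ) dτ` has derivative `R(p, t)` at `t`
  have hF : HasDerivAt (fun r ↦ ∫ τ in t..r, Rp τ) (Rp t) t :=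
    intervalIntegral.integral_hasDerivAt_right IntervalIntegrable.refl
      (hRi.stronglyMeasurableAtFilter isOpen_interior t ht) hRat
  -- `G r = exp (−F r) ρ(g(t), g₀)(p)` agrees with `ρ(g(r), g₀)(p)` for `r ∈ S`
  set C : ℝ := (g t).densityRatio g₀ p with hC
  have hG : HasDerivAt (fun r ↦ Real.exp (-∫ τ in t..r, Rp τ) * C)
      (Real.exp (-∫ τ in t..t, Rp τ) * -Rp t * C) t :=
    (hF.neg.exp).mul_const C
  have heq : (fun r ↦ (g r).densityRatio g₀ p) =ᶠ[𝓝 t]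
      fun r ↦ Real.exp (-∫ τ in t..r, Rp τ) * C := by
    filter_upwards [mem_interior_iff_mem_nhds.1 ht] with r hr
    exact hflow.densityRatio_eq_exp_mul_densityRatio hS hR hR₀ htS hr p
  refine (hG.congr_of_eventuallyEq heq).congr_deriv ?_
  rw [intervalIntegral.integral_same, neg_zero, Real.exp_zero, one_mul, hC]

/-- **`∂ₜ log ρ(g(t), g₀) = −R`**: the logarithmic time derivative of the density ratio along a
Ricci flow is minus the scalar curvature (interior times). [cite: Topping2006, (2.5.7) (p. 33)] -/
theorem IsRicciFlow.deriv_densityRatio_div [I.Boundaryless] (hflow : IsRicciFlow g cov S)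
    (hS : Convex ℝ S) (hR : ∀ t ∈ S, (g t).IsRiemannian) (hR₀ : g₀.IsRiemannian) {t : ℝ}
    (ht : t ∈ interior S) (p : M) :
    deriv (fun r ↦ (g r).densityRatio g₀ p) t / (g t).densityRatio g₀ p =
      -(g t).scalarCurvatureWith (cov t) p := by
  rw [(hflow.hasDerivAt_densityRatio hS hR hR₀ ht p).deriv]
  have hpos := densityRatio_pos (g₀ := g₀) (hR t (interior_subset ht)) hR₀ p
  field_simp

/-- **The time-reversed form**: for `σ ↦ g(−σ)`, `∂_σ ρ(g(−σ), g₀)/ρ(g(−σ), g₀) = R(·, −σ)` at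
every `σ` with `−σ` interior to the time set (the zeroth-order coefficient of the heat-type
equation of the time-reversed conjugate heat kernel, Bamler 2020a, §2.3).
[cite: Topping2006, (2.5.7) (p. 33)] -/
theorem IsRicciFlow.deriv_densityRatio_comp_neg_div [I.Boundaryless] (hflow : IsRicciFlow g cov S)
    (hS : Convex ℝ S) (hR : ∀ t ∈ S, (g t).IsRiemannian) (hR₀ : g₀.IsRiemannian) {σ : ℝ}
    (hσ : -σ ∈ interior S) (p : M) :
    deriv (fun σ' ↦ (g (-σ')).densityRatio g₀ p) σ / (g (-σ)).densityRatio g₀ p =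
      (g (-σ)).scalarCurvatureWith (cov (-σ)) p := by
  rw [deriv_comp_neg (fun r ↦ (g r).densityRatio g₀ p) σ,
    (hflow.hasDerivAt_densityRatio hS hR hR₀ hσ p).deriv]
  have hpos := densityRatio_pos (g₀ := g₀) (hR (-σ) (interior_subset hσ)) hR₀ p
  field_simp

end Literature.Geometry.Riemannian

end
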